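import Summits.ResolutionOfSingularities.ResolutionOfSingularities.Theorems.PurelyInseparableDim4Perm2BoundAttained
import Summits.ResolutionOfSingularities.ResolutionOfSingularities.Theorems.PurelyInseparableDim4Perm2BoundSharpStep
import HarnessLib

/-!
# [OURS · res-dim4-pi PR-2, part 8] Tight edges from the INPUT side, and the sharp family read through
  part 6a: its POINT blow-up realises Moh's maximal jump `+pᵉ` in four variables

Cell `res-dim4-pi` (D-0157 DOOR 2), lineage **PR-2** (seat `res-dim4-p-2`, generation 3), part 8 (sequel of
`…Perm2BoundAttained`, part 6a, p672725, and `…Perm2BoundSharpStep`, part 5b, p662814; notation as there).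
Part 6a's criterion «TIGHT» (the initial form of the new residual polynomial `F′` contains a monomial whose
exponents off the centre are exactly the exceptional ones, `E_i = r_i` for `i ∉ S`) reads the OUTPUT `F′`. Here:

* §1 **input-side sufficient conditions**: `exists_apply_eq_of_mem_support_step` — a coordinate-centre step at a
  point over the origin never touches the exponents off `S` (every monomial of `F′` has the off-`S` exponents of
  a monomial of `F`); hence `exists_tight_of_forall_apply_eq` — if the variables off the centre occur in `F` only
  through the exceptional monomial (`d_i = r_i` for every monomial `x^d` of `F` and every `i ∉ S`, i.e.
  `F = x_N^{r_N} · G(x_S)`), the edge is tight as soon as `F′ ≠ 0`; `exists_tight_of_univ` — the point blow-up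
  itself (`S = univ`) is trivially tight;
* §2 for such `F` the transfer is an EQUALITY `d′ + g = d′_pt + d` at every `q`
  (`shade_step_add_eq_of_forall_apply_eq`), and at `q = p`:
  `d′ + g = 2d + 1 ⟺ the point blow-up at the same point is a kangaroo`
  (`shade_step_add_eq_two_mul_add_one_iff_of_forall_apply_eq`);
* §3 **the sharp family of parts 5a/5b read through part 6a**: `SharpFamily.pointStep_shade_eq` — for every prime
  `p` and every `e`, the POINT blow-up of the four-variable state `F = x₂ⁿ x₄^{pᵉ} (x₂ − x₄ + x₁x₃)^q`
  (`q = p^{e+1}`, `n = pᵉ(p−1)`, `r = (0, n, 0, pᵉ)`, shade `q`) at the point `x₄ = 1` of the `x₂`-chart has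
  shade EXACTLY `q + pᵉ = d + p^{(e+1)−1}`: Moh's bound for POINT blow-ups is attained by this four-variable family
  (the tree's `PointBlowup.mohBound_attained` is a two-variable monomial family) — with NO new computation:
  part 5b's equality `translatedBound_attained` forces, by part 6a's `shade_step_add_eq_two_mul_add_pow_iff`, both
  tightness of the coordinate-centre edge and the maximal jump of the point blow-up.

[OURS · counted 0 · AI work weaker than expert review] NOTHING here proves resolution of singularities in
dimension ≥ 4 / characteristic `p`: bookkeeping of the letter `d` of OUR candidate frame (MODE 1h coordinate game);
census value. bears_on: LADDER-RESOLUTION:D157-DOOR2 (res-dim4-pi · PR-2).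
Supports stmt-ResolutionOfSingularities-16155 (helper).
-/

noncomputable section

set_option linter.dupNamespace false -- mandated namespace of this single-conjunct summit
open MvPolynomial Finset
open scoped BigOperators

namespace Summit.ResolutionOfSingularities.ResolutionOfSingularities.Theorems.PIDim4
namespace Perm2Bound
open Literature.AlgebraicGeometry.Resolution
open Literature.AlgebraicGeometry.Resolution.CentreBlowup
open Literature.AlgebraicGeometry.Resolution.Hauser2010

/-! ### §1 Input-side sufficient conditions for tightness -/

section Input
variable {σ : Type*} {K : Type*} [Field K] [Fintype σ] [DecidableEq σ] [DecidableEq K]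

/-- **A coordinate-centre step never touches the exponents off the centre** (`j ∈ S`, point over the origin:
`b = 0` off `S`): every monomial `x^E` of `F′` comes from a monomial `x^d` of `F` with `E_i = d_i` for all
`i ∉ S`. [folklore] -/
theorem exists_apply_eq_of_mem_support_step (q : ℕ) {S : Finset σ} {j : σ} (hj : j ∈ S) (b : σ → K)
    (hbN : ∀ i, i ∉ S → b i = 0) (s : CState σ K) {E : σ →₀ ℕ} (hE : E ∈ (step q S j b s).F.support) :
    ∃ d ∈ s.F.support, ∀ i, i ∉ S → E i = d i := by
  have hE' : coeff E (pointTransform q S j b s) ≠ 0 := by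
    have h := MvPolynomial.mem_support_iff.mp hE
    change coeff E (deletePthPowers q (pointTransform q S j b s)) ≠ 0 at h
    rw [coeff_deletePthPowers] at h
    split_ifs at h with hP
    · exact (h rfl).elim
    · exact h
  rw [pointTransform_eq_sum, coeff_sum] at hE'
  obtain ⟨d, hd, hne⟩ := Finset.exists_ne_zero_of_sum_ne_zero hE'
  refine ⟨d, hd, fun i hi => ?_⟩
  have hij : i ≠ j := fun h => hi (h ▸ hj)
  rw [PointBlowup.apply_eq_of_coeff_translate_monomial_ne_zero b (hbN i hi) hne,
    chartExponent_apply_of_ne q S hij]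

/-- If the variables off the centre occur in `F` only through the exceptional monomial (`d_i = r_i` off `S` on
every monomial), then so do they in `F′`. [folklore] -/
theorem forall_apply_eq_of_mem_support_step (q : ℕ) {S : Finset σ} {j : σ} (hj : j ∈ S) (b : σ → K)
    (hbN : ∀ i, i ∉ S → b i = 0) (s : CState σ K)
    (hF : ∀ d ∈ s.F.support, ∀ i, i ∉ S → d i = s.r i) {E : σ →₀ ℕ}
    (hE : E ∈ (step q S j b s).F.support) : ∀ i, i ∉ S → E i = s.r i := by
  obtain ⟨d, hd, hEd⟩ := exists_apply_eq_of_mem_support_step q hj b hbN s hE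
  intro i hi
  rw [hEd i hi, hF d hd i hi]

/-- **`F = x_N^{r_N} · G(x_S)` ⇒ TIGHT**: if the variables off the centre occur in `F` only through the
exceptional monomial and `F′ ≠ 0`, the initial form of `F′` contains (indeed: consists of) monomials with
`E_i = r_i` off `S` — part 6a's tightness criterion holds. [folklore] -/
theorem exists_tight_of_forall_apply_eq (q : ℕ) {S : Finset σ} {j : σ} (hj : j ∈ S) (b : σ → K)
    (hbN : ∀ i, i ∉ S → b i = 0) (s : CState σ K)
    (hF : ∀ d ∈ s.F.support, ∀ i, i ∉ S → d i = s.r i) (ht : (step q S j b s).F ≠ 0) :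
    ∃ E ∈ (step q S j b s).F.support,
      (E.degree : ℕ∞) = ordZero (step q S j b s).F ∧ ∀ i, i ∉ S → E i = s.r i := by
  obtain ⟨oG, hoG⟩ := exists_ordZero_eq_natCast ht
  obtain ⟨⟨E, hE, hEdeg⟩, -⟩ := (ordZero_eq_nat_iff _ _).mp hoG
  have hEs : E ∈ (step q S j b s).F.support := MvPolynomial.mem_support_iff.mpr hE
  exact ⟨E, hEs, by rw [hoG, hEdeg], forall_apply_eq_of_mem_support_step q hj b hbN s hF hEs⟩

/-- **The point blow-up (`S = univ`) is trivially tight.** [folklore] -/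
theorem exists_tight_of_univ (q : ℕ) (j : σ) (b : σ → K) (s : CState σ K)
    (ht : (step q Finset.univ j b s).F ≠ 0) :
    ∃ E ∈ (step q Finset.univ j b s).F.support,
      (E.degree : ℕ∞) = ordZero (step q Finset.univ j b s).F ∧ ∀ i, i ∉ Finset.univ → E i = s.r i := by
  obtain ⟨oG, hoG⟩ := exists_ordZero_eq_natCast ht
  obtain ⟨⟨E, hE, hEdeg⟩, -⟩ := (ordZero_eq_nat_iff _ _).mp hoG
  exact ⟨E, MvPolynomial.mem_support_iff.mpr hE, by rw [hoG, hEdeg],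
    fun i hi => absurd (Finset.mem_univ i) hi⟩

/-! ### §2 Consequences: transfer equality and the `e = 1` criterion for such `F` -/

/-- **`F = x_N^{r_N} · G(x_S)` ⇒ the transfer is an equality `d′ + g = d′_pt + d`** (every `q`; `x^r ∣ F`,
condition (1), `ord_{(x_S)} F = Σ_S r_i + g`, point over the origin of the centre). [folklore] -/
theorem shade_step_add_eq_of_forall_apply_eq {q : ℕ} {S : Finset σ} {j : σ} (hj : j ∈ S) (b : σ → K)
    (hbj : b j = 0) (hbN : ∀ i, i ∉ S → b i = 0) (s : CState σ K) {o : ℕ} (ho : ordZero s.F = o)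
    (hr : ∀ d ∈ s.F.support, s.r ≤ d) (hq : ∀ d ∈ s.F.support, q ≤ degIn S d) {g : ℕ}
    (hg : ordAlong S s.F = ((degIn S s.r + g : ℕ) : ℕ∞))
    (hF : ∀ d ∈ s.F.support, ∀ i, i ∉ S → d i = s.r i) :
    (step q S j b s).shade + (g : ℕ∞) = (PointBlowup.step q j b s.toState).shade + s.shade := by
  by_cases ht : (step q S j b s).F = 0
  · have hφ := lift_step_F q hj b hbj hbN s hq
    have hpt : (PointBlowup.step q j b s.toState).F = 0 := by rw [← hφ, ht, map_zero]
    have h1 : (step q S j b s).shade = ⊤ := by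
      unfold CState.shade; rw [ht, ordZero_zero, ENat.top_sub_coe]
    have h2 : (PointBlowup.step q j b s.toState).shade = ⊤ := by
      unfold PointBlowup.State.shade; rw [hpt, ordZero_zero, ENat.top_sub_coe]
    rw [h1, h2, top_add, top_add]
  obtain ⟨oG, hoG⟩ := exists_ordZero_eq_natCast ht
  obtain ⟨E, hE, hEdeg, hEi⟩ := exists_tight_of_forall_apply_eq q hj b hbN s hF ht
  have hEdeg' : E.degree = oG := by
    rw [hoG] at hEdeg
    exact_mod_cast hEdeg
  exact (shade_step_add_eq_shade_pointStep_add_iff hj b hbj hbN s ho hr hq hg hoG).mpr ⟨E, hE, hEdeg', hEi⟩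

/-- **`F = x_N^{r_N} · G(x_S)`, class `q = p`: `d′ + g = 2d + 1 ⟺ the point blow-up at the same point is a
kangaroo** (`PointBlowup.ShadeIncreases p j b (F, r)`); tightness is automatic by §1
(`CentreBlowup.step_F_ne_zero` supplies `F′ ≠ 0`). [cite: Moh1987, Stability Theorem, §1 (p. 972)]
[cite: HauserPerlega2019PRIMS, §3 Theorem (9) and Comment (d)] -/
theorem shade_step_add_eq_two_mul_add_one_iff_of_forall_apply_eq (p : ℕ) [Fact p.Prime] [CharP K p]
    {S : Finset σ} {j : σ} (hj : j ∈ S) (b : σ → K) (hbj : b j = 0) (hbN : ∀ i, i ∉ S → b i = 0)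
    (s : CState σ K) (hclean : deletePthPowers p s.F = s.F) {o : ℕ} (ho : ordZero s.F = o)
    (hr : ∀ d ∈ s.F.support, s.r ≤ d) (hq : ∀ d ∈ s.F.support, p ≤ degIn S d) {g : ℕ}
    (hg : ordAlong S s.F = ((degIn S s.r + g : ℕ) : ℕ∞))
    (hF : ∀ d ∈ s.F.support, ∀ i, i ∉ S → d i = s.r i) :
    (step p S j b s).shade + (g : ℕ∞) = 2 * s.shade + 1 ↔ PointBlowup.ShadeIncreases p j b s.toState := by
  rw [shade_step_add_eq_two_mul_add_one_iff p hj b hbj hbN s hclean ho hr hq hg]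
  refine ⟨fun h => h.2, fun hinc => ⟨?_, hinc⟩⟩
  exact exists_tight_of_forall_apply_eq p hj b hbN s hF
    (CentreBlowup.step_F_ne_zero p hj b hbj hbN s hclean ho hr hq)

end Input

/-! ### §3 The sharp family through part 6a: Moh's maximal jump of a POINT blow-up in four variables -/

namespace SharpFamily

variable {K : Type*} [Field K] [DecidableEq K] (p : ℕ) [hp : Fact p.Prime] [CharP K p]

/-- **Moh's bound for point blow-ups is attained by the sharp family, in four variables, for every `p` and `e`.**
For `q = p^{e+1}`, `n = pᵉ(p−1)` and the state `s = (x₂ⁿ x₄^{pᵉ} (x₂ − x₄ + x₁x₃)^q, r = (0,n,0,pᵉ), {x₂,x₄})` of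
parts 5a/5b (shade `q`), the POINT blow-up at the point `x₄ = 1` of the `x₂`-chart has shade `s.shade + pᵉ =
q + pᵉ` — equality in `PointBlowup.mohBound` — and the coordinate-centre edge of part 5b along `V(z, x₂, x₄)` is
TIGHT: both forced by part 5b's equality `translatedBound_attained` through part 6a's
`shade_step_add_eq_two_mul_add_pow_iff`. [cite: Moh1987, Stability Theorem (one permissible blow-up), §1]
[cite: HauserPerlega2019PRIMS, §3 Theorem (9)] -/
theorem pointStep_shade_eq (e : ℕ) :
    (PointBlowup.step (p ^ (e + 1)) 1 (pt K) (parent (p ^ (e + 1)) (p ^ e * (p - 1)) (p ^ e) K).toState).shade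
        = (parent (p ^ (e + 1)) (p ^ e * (p - 1)) (p ^ e) K).shade + ((p ^ e : ℕ) : ℕ∞) ∧
    (PointBlowup.step (p ^ (e + 1)) 1 (pt K) (parent (p ^ (e + 1)) (p ^ e * (p - 1)) (p ^ e) K).toState).shade
        = ((p ^ (e + 1) + p ^ e : ℕ) : ℕ∞) ∧
    ∃ E ∈ (step (p ^ (e + 1)) {1, 3} 1 (pt K) (parent (p ^ (e + 1)) (p ^ e * (p - 1)) (p ^ e) K)).F.support,
      (E.degree : ℕ∞) =
          ordZero (step (p ^ (e + 1)) {1, 3} 1 (pt K) (parent (p ^ (e + 1)) (p ^ e * (p - 1)) (p ^ e) K)).F ∧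
        ∀ i, i ∉ ({1, 3} : Finset (Fin 4)) → E i = (parent (p ^ (e + 1)) (p ^ e * (p - 1)) (p ^ e) K).r i := by
  obtain ⟨⟨he, hj, hbj, hbN, hclean, ho, hr, hq, hg⟩, heq, hshade, -⟩ := translatedBound_attained p (K := K) e
  obtain ⟨htight, hpt⟩ := (shade_step_add_eq_two_mul_add_pow_iff p he hj (pt K) hbj hbN _ hclean ho hr hq
    hg).mp heq
  have he' : e + 1 - 1 = e := by omega
  rw [he'] at hpt
  refine ⟨hpt, ?_, htight⟩
  rw [hpt, hshade]
  norm_cast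

/-- In the tree's words: Moh's bound `PointBlowup.MohBound p (e+1) 1 (pt K) s` holds with EQUALITY for the sharp
family's parent state. [cite: Moh1987, Stability Theorem (one permissible blow-up), §1] -/
theorem mohBound_attained_dim4 (e : ℕ) :
    PointBlowup.MohBound p (e + 1) 1 (pt K) (parent (p ^ (e + 1)) (p ^ e * (p - 1)) (p ^ e) K).toState ∧
    (PointBlowup.step (p ^ (e + 1)) 1 (pt K) (parent (p ^ (e + 1)) (p ^ e * (p - 1)) (p ^ e) K).toState).shade
        = (parent (p ^ (e + 1)) (p ^ e * (p - 1)) (p ^ e) K).toState.shade + ((p ^ (e + 1 - 1) : ℕ) : ℕ∞) := by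
  obtain ⟨hpt, -, -⟩ := pointStep_shade_eq p (K := K) e
  have he' : e + 1 - 1 = e := by omega
  have hs : (parent (p ^ (e + 1)) (p ^ e * (p - 1)) (p ^ e) K).toState.shade =
      (parent (p ^ (e + 1)) (p ^ e * (p - 1)) (p ^ e) K).shade := rfl
  refine ⟨?_, ?_⟩
  · unfold PointBlowup.MohBound
    rw [he', hs, hpt]
  · rw [he', hs, hpt]

end SharpFamily

end Perm2Bound
end Summit.ResolutionOfSingularities.ResolutionOfSingularities.Theorems.PIDim4

end
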